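import Literature.AnabelianGeometry.EtaleTheta.ContH1
import HarnessLib

/-!
# Continuous `H¹`: the conjugation action is an action (support lemmas for [EtTh] §1, Rmk. 1.9.1)

[EtTh] (Mochizuki, Publ. RIMS **45** (2009)) §1 lets `Π^tp_X` act on `H¹(Π^tp_Ÿ, Δ_Θ)` by conjugation
and speaks of "the `Π^tp_Ẋ/Π^tp_Ÿ ≅ Z`-orbit of `η̈^Θ`" (Def. 1.9, PRIMS PDF p. 29), asserting in
Remark 1.9.1 (p. 29) that "any inner automorphism of `Π^tp_Ċ` arising from `Π^tp_Ẋ` acts trivially on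
`η̈^{Θ,Z}`" [cite: MochizukiEtTh2009, Rmk 1.9.1 p.29]. For the concrete continuous `H¹` of `ContH1.lean`
(`ContH1.conj φ A σ : H¹(H, A) → H¹(H, A)`, `H` normal in `G`) this file PROVES the action laws that
make such orbit statements formal consequences of the definitions:

* `ContH1.conjCocycle_apply`, `conjCocycle_one`, `conjCocycle_mul` — on cocycles;
* `ContH1.conj_mk`, `conj_one_apply`, `conj_mul_apply`, `conj_inv_conj_apply`,
  `conj_conj_inv_apply` — on classes (`σ ↦ conj σ` is a homomorphism `G → Aut H¹(H, A)`);
* `ContH1.image_conj_orbit_eq` — for a subgroup `S ≤ G` and `σ ∈ S`, conjugation by `σ` carries the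
  `S`-orbit `{conj τ x | τ ∈ S}` of a class `x` onto itself (the shape of [EtTh] Rmk. 1.9.1, first
  clause, whose `S` is `Π^tp_X ∩ Π^tp_Ẋ` and whose orbit is `η̈^{Θ,Z}`).

Classical ([cite: NeukirchSchmidtWingberg2008, I §5]); proof-only companion of `ContH1.lean` (no
definitions, no statement of [EtTh] asserted). Seat abc-iut-L6-t12 (cell abc-iut, unit W2-L2-09).
-/

namespace Literature.AnabelianGeometry.EtaleTheta

namespace ContH1

variable {G G' : Type*} [Group G] [TopologicalSpace G] [IsTopologicalGroup G]
  [Group G'] [TopologicalSpace G'] [IsTopologicalGroup G']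
  {φ : G →* G'} {A : Subgroup G'} [A.Normal] [IsMulCommutative A] {H : Subgroup G} [H.Normal]

open scoped IsMulCommutative

/-- The conjugate cocycle, evaluated: `(σ·f)(h) = φ(σ) f(σ⁻¹ h σ) φ(σ)⁻¹` (definition of
`conjCocycle`). [cite: NeukirchSchmidtWingberg2008, I §5] -/
theorem conjCocycle_apply (σ : G) (f : contCocycles φ A H) (h : H) :
    (conjCocycle φ A σ f).1 h = MulAut.conjNormal (φ σ) (f.1 (MulAut.conjNormal σ⁻¹ h)) :=
  rfl

/-- Conjugating a cocycle by `1` does nothing. [cite: NeukirchSchmidtWingberg2008, I §5] -/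
theorem conjCocycle_one (f : contCocycles φ A H) : conjCocycle φ A (1 : G) f = f := by
  apply Subtype.ext
  funext h
  simp only [conjCocycle_apply, map_one, inv_one, MulAut.one_apply]

/-- Conjugation of cocycles is multiplicative in the conjugating element:
`(στ)·f = σ·(τ·f)`. [cite: NeukirchSchmidtWingberg2008, I §5] -/
theorem conjCocycle_mul (σ τ : G) (f : contCocycles φ A H) :
    conjCocycle φ A (σ * τ) f = conjCocycle φ A σ (conjCocycle φ A τ f) := by
  apply Subtype.ext
  funext h
  simp only [conjCocycle_apply, map_mul, mul_inv_rev, MulAut.mul_apply]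

/-- `conj σ` on the class of a cocycle is the class of the conjugate cocycle.
[cite: NeukirchSchmidtWingberg2008, I §5] -/
theorem conj_mk (σ : G) (f : contCocycles φ A H) :
    conj φ A σ (QuotientGroup.mk f : ContH1 φ A H) = QuotientGroup.mk (conjCocycle φ A σ f) :=
  rfl

/-- **`1` acts trivially** on `H¹(H, A)`. [cite: NeukirchSchmidtWingberg2008, I §5] -/
theorem conj_one_apply (x : ContH1 φ A H) : conj φ A (1 : G) x = x := by
  induction x using QuotientGroup.induction_on with
  | H f => rw [conj_mk, conjCocycle_one]

/-- **The conjugation action on `H¹(H, A)` is an action**: `conj (στ) = conj σ ∘ conj τ`.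
[cite: NeukirchSchmidtWingberg2008, I §5] -/
theorem conj_mul_apply (σ τ : G) (x : ContH1 φ A H) :
    conj φ A (σ * τ) x = conj φ A σ (conj φ A τ x) := by
  induction x using QuotientGroup.induction_on with
  | H f => rw [conj_mk, conj_mk, conj_mk, conjCocycle_mul]

/-- `conj σ⁻¹` undoes `conj σ`. [cite: NeukirchSchmidtWingberg2008, I §5] -/
theorem conj_inv_conj_apply (σ : G) (x : ContH1 φ A H) : conj φ A σ⁻¹ (conj φ A σ x) = x := by
  rw [← conj_mul_apply, inv_mul_cancel, conj_one_apply]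

/-- `conj σ` undoes `conj σ⁻¹`. [cite: NeukirchSchmidtWingberg2008, I §5] -/
theorem conj_conj_inv_apply (σ : G) (x : ContH1 φ A H) : conj φ A σ (conj φ A σ⁻¹ x) = x := by
  rw [← conj_mul_apply, mul_inv_cancel, conj_one_apply]

/-- `conj σ` is a bijection of `H¹(H, A)` (with inverse `conj σ⁻¹`).
[cite: NeukirchSchmidtWingberg2008, I §5] -/
theorem conj_bijective (σ : G) : Function.Bijective (conj φ A σ : ContH1 φ A H → ContH1 φ A H) :=
  ⟨fun x y hxy => by rw [← conj_inv_conj_apply σ x, hxy, conj_inv_conj_apply],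
    fun y => ⟨conj φ A σ⁻¹ y, conj_conj_inv_apply σ y⟩⟩

/-- **Orbits under a subgroup are stable under that subgroup**: for `S ≤ G`, `σ ∈ S` and a class
`x ∈ H¹(H, A)`, conjugation by `σ` maps the `S`-orbit `{conj τ x | τ ∈ S}` onto itself. This is the
formal content of [EtTh] Rmk. 1.9.1, first clause ("any inner automorphism … arising from `Π^tp_Ẋ`
acts trivially on `η̈^{Θ,Z}`", the `Π^tp_Ẋ/Π^tp_Ÿ`-orbit of `η̈^Θ`, p. 29), for any subgroup in place
of `Π^tp_X ∩ Π^tp_Ẋ`. [cite: MochizukiEtTh2009, Rmk 1.9.1 p.29] -/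
theorem image_conj_orbit_eq (S : Subgroup G) {σ : G} (hσ : σ ∈ S) (x : ContH1 φ A H) :
    conj φ A σ '' {y | ∃ τ : G, τ ∈ S ∧ y = conj φ A τ x} =
      {y | ∃ τ : G, τ ∈ S ∧ y = conj φ A τ x} := by
  ext y
  constructor
  · rintro ⟨z, ⟨τ, hτ, rfl⟩, rfl⟩
    exact ⟨σ * τ, S.mul_mem hσ hτ, (conj_mul_apply σ τ x).symm⟩
  · rintro ⟨τ, hτ, rfl⟩
    refine ⟨conj φ A (σ⁻¹ * τ) x, ⟨σ⁻¹ * τ, S.mul_mem (S.inv_mem hσ) hτ, rfl⟩, ?_⟩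
    rw [← conj_mul_apply, mul_inv_cancel_left]

end ContH1

end Literature.AnabelianGeometry.EtaleTheta
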